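import Mathlib.LinearAlgebra.Matrix.Determinant.Basic
import Mathlib.LinearAlgebra.Matrix.Notation
import Mathlib.RingTheory.Ideal.Operations
import Mathlib.RingTheory.Ideal.Span
import Mathlib.RingTheory.Nilpotent.Basic
import Mathlib.Tactic.LinearCombination
import Mathlib.Tactic.FinCases
import HarnessLib

/-!
# THE ONE-BLOCK MATRIX `W′ = z·I₈ + N_g` OF THE FROBENIUS NORM OF THE SPECIMEN P2d4C: `W′² = (z² + g)·1`, `det W′ = (z² + g)⁴`, `I₁ ⊆ 𝔫`, `𝔫² ⊆ I₂`
# (kernel piece (Q) of LEMMA N♭; crux `FInjectiveMacaulayfication` stmt-ResolutionOfSingularities-15315, chain w45a, F-centre census Tier-1/Tier-2;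
# res-L1-w45a-plan-1 R17.14 (3); seat res-L1-w45a-lead-1 g8; scope memo `Cruxes/FInjectiveMacaulayfication/Lines/LEMMA-N-SCOPE.md`)

[OURS · L1 W4.5a] Support file (`--supports stmt-ResolutionOfSingularities-15315 --as helper`); replaces the role of NO printed item; NOT a statement
of any manuscript; def-free; AI-written (AI review is weaker than expert review).

For `A₀ = k[x,y,u,t,z]/(z² + x⁴z + g)`, `g = y³+u³+t³`, `char k = 2`, `k` perfect, the `A₀`-module `F_*A₀ ≅ A₀^{1/2}` has, in the `K`-basis `{√ν}` of `K^{1/2}`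
(`ν` the 16 square-free monomials in `x,y,u,t`), the coordinate matrix `[I₁₆ ; x⁻²·diag(W′, W′)]` with ONE 8×8 block (the `x`-parity of `ν` is untouched):
`W′ = z·I₈ + N_g`, `N_g` = the matrix of multiplication by `√g = y√y + u√u + t√t` on `⊕_{ν ⊆ {y,u,t}} R√ν` (index order `∅, y, u, t, yu, yt, ut, yut`):
row `ν`, column `ν ⊕ s` carries `s` if `s ∉ ν` and `s²` if `s ∈ ν`. This file records the matrix (as a hypothesis `hW : W = !![…]`, def-free) and proves:

* `mul_self_eq_smul_one` — over any commutative ring with `2 = 0`: `W′ * W′ = (z² + (y³+u³+t³)) • 1` (hence `= x⁴z • 1` modulo `f`);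
* `det_eq_pow_four` — over a REDUCED ring with `2 = 0`: `det W′ = (z² + (y³+u³+t³))⁴` (from `(det W′)² = (z²+g)⁸` and uniqueness of square roots in
  characteristic 2); `sq_eq_sq_iff_of_two_eq_zero` is the lemma;
* `entry_mem_span` — every entry of `W′` lies in `𝔫 = (z, y, u, t)`; `det_mem_pow_of_forall_mem` (general): a determinant with entries in `I` lies in
  `I ^ card`; hence every `k`-minor of `W′` lies in `𝔫ᵏ` (`det_submatrix_mem_pow`);
* `sq_span_le_span_minors_two` — `𝔫² ≤ I₂(W′)`, the ideal generated by the 2×2 minors `det (W′.submatrix r c)` (`r c : Fin 2 → Fin 8` injective), by ten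
  explicit minors (`y², u², t², yu, yt, ut, zy, zu, zt` are minors on the nose, `z² = (z² − y³) + y·y²`).
The PURE-GF(2) script `L/res-L1-w45a-lead-1/check_W2.py` independently confirms `W′² = (z²+g)·I` and `det W′ = (z²+g)⁴`.
[folklore linear algebra; the matrix is idea-1's FB5-r1 §1 engine block `P_λ z + P_{λB}` divided by `x²`, re-derived by hand (lead-1 06:16:33Z, tri-2 g14 06:19:19Z)]
-/

-- single-problem summit: the doubled namespace component is forced
set_option linter.dupNamespace false

namespace Summit.ResolutionOfSingularities.ResolutionOfSingularities.Theorems.FInjectiveMacaulayfication.NormBlockMatrix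

open Matrix

variable {R : Type*} [CommRing R]

/-! ## §1 `W′² = (z² + g)·1` in characteristic 2 -/

/-- **`W′ * W′ = (z² + (y³+u³+t³)) • 1`** over any commutative ring in which `2 = 0`: the diagonal of `W′²` is `z² + y·y² + u·u² + t·t²`, every
off-diagonal entry is twice something. [folklore; checked independently over GF(2)[x,y,u,t,z] by `check_W2.py`] -/
theorem mul_self_eq_smul_one (h2 : (2 : R) = 0) (y u t z : R) (W : Matrix (Fin 8) (Fin 8) R)
    (hW : W = !![z, y, u, t, 0, 0, 0, 0;
      y ^ 2, z, 0, 0, u, t, 0, 0;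
      u ^ 2, 0, z, 0, y, 0, t, 0;
      t ^ 2, 0, 0, z, 0, y, u, 0;
      0, u ^ 2, y ^ 2, 0, z, 0, 0, t;
      0, t ^ 2, 0, y ^ 2, 0, z, 0, u;
      0, 0, t ^ 2, u ^ 2, 0, 0, z, y;
      0, 0, 0, 0, t ^ 2, u ^ 2, y ^ 2, z]) :
    W * W = (z ^ 2 + (y ^ 3 + u ^ 3 + t ^ 3)) • (1 : Matrix (Fin 8) (Fin 8) R) := by
  have h2' : ∀ a : R, a * 2 = 0 := fun a => by rw [h2, mul_zero]
  subst hW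
  ext i j
  fin_cases i <;> fin_cases j <;>
    simp [Matrix.mul_apply, Fin.sum_univ_eight] <;> ring_nf <;> simp [h2']

/-! ## §2 `det W′ = (z² + g)⁴` in a reduced ring of characteristic 2 -/

/-- In a reduced commutative ring with `2 = 0`, squares have unique square roots: `a² = b² ↔ a = b` (since `(a + b)² = a² + b² = 2a² = 0`
and `a = −b = b`). [folklore] -/
theorem sq_eq_sq_iff_of_two_eq_zero [IsReduced R] (h2 : (2 : R) = 0) (a b : R) : a ^ 2 = b ^ 2 ↔ a = b := by
  refine ⟨fun h => ?_, fun h => by rw [h]⟩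
  have hsq : (a + b) ^ 2 = 0 := by
    have : (a + b) ^ 2 = a ^ 2 + b ^ 2 + a * b * 2 := by ring
    rw [this, h, h2, mul_zero, add_zero, ← two_mul, h2, zero_mul]
  have hab : a + b = 0 := IsReduced.eq_zero _ ⟨2, hsq⟩
  have hbb : b + b = 0 := by rw [← two_mul, h2, zero_mul]
  linear_combination hab - hbb

/-- **`det W′ = (z² + (y³+u³+t³))⁴`** over a REDUCED commutative ring with `2 = 0` (in particular over the domain `A₀` and its localisations, where it
reads `det W′ = (x⁴z)⁴ = x¹⁶z⁴`). From `W′² = (z²+g)•1`: `(det W′)² = (z²+g)⁸`, and square roots are unique. [folklore] -/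
theorem det_eq_pow_four [IsReduced R] (h2 : (2 : R) = 0) (y u t z : R) (W : Matrix (Fin 8) (Fin 8) R)
    (hW : W = !![z, y, u, t, 0, 0, 0, 0;
      y ^ 2, z, 0, 0, u, t, 0, 0;
      u ^ 2, 0, z, 0, y, 0, t, 0;
      t ^ 2, 0, 0, z, 0, y, u, 0;
      0, u ^ 2, y ^ 2, 0, z, 0, 0, t;
      0, t ^ 2, 0, y ^ 2, 0, z, 0, u;
      0, 0, t ^ 2, u ^ 2, 0, 0, z, y;
      0, 0, 0, 0, t ^ 2, u ^ 2, y ^ 2, z]) :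
    W.det = (z ^ 2 + (y ^ 3 + u ^ 3 + t ^ 3)) ^ 4 := by
  have hmul := mul_self_eq_smul_one h2 y u t z W hW
  have hdet : W.det ^ 2 = ((z ^ 2 + (y ^ 3 + u ^ 3 + t ^ 3)) ^ 4) ^ 2 := by
    have := congrArg Matrix.det hmul
    rw [det_mul, det_smul, det_one, mul_one, Fintype.card_fin] at this
    rw [sq, this]
    ring
  exact (sq_eq_sq_iff_of_two_eq_zero h2 _ _).mp hdet

/-! ## §3 Entries and minors lie in powers of `𝔫 = (z, y, u, t)` -/

/-- **A determinant with all entries in an ideal `I` lies in `I ^ card`** (every term of the Leibniz expansion is a product of `card` entries). [folklore] -/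
theorem det_mem_pow_of_forall_mem {n : Type*} [Fintype n] [DecidableEq n] (I : Ideal R) (M : Matrix n n R) (h : ∀ i j, M i j ∈ I) :
    M.det ∈ I ^ Fintype.card n := by
  rw [Matrix.det_apply]
  refine Submodule.sum_mem _ fun σ _ => ?_
  rw [Units.smul_def, zsmul_eq_mul]
  refine Ideal.mul_mem_left _ _ ?_
  have hprod := Ideal.prod_mem_prod (s := Finset.univ) (I := fun _ : n => I) (x := fun i => M (σ i) i) fun i _ => h (σ i) i
  rwa [Finset.prod_const, Finset.card_univ] at hprod

/-- **Every entry of `W′` lies in `𝔫 = (z, y, u, t)`.** [by inspection] -/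
theorem entry_mem_span (y u t z : R) (W : Matrix (Fin 8) (Fin 8) R)
    (hW : W = !![z, y, u, t, 0, 0, 0, 0;
      y ^ 2, z, 0, 0, u, t, 0, 0;
      u ^ 2, 0, z, 0, y, 0, t, 0;
      t ^ 2, 0, 0, z, 0, y, u, 0;
      0, u ^ 2, y ^ 2, 0, z, 0, 0, t;
      0, t ^ 2, 0, y ^ 2, 0, z, 0, u;
      0, 0, t ^ 2, u ^ 2, 0, 0, z, y;
      0, 0, 0, 0, t ^ 2, u ^ 2, y ^ 2, z]) (i j : Fin 8) :
    W i j ∈ Ideal.span ({z, y, u, t} : Set R) := by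
  have hz : z ∈ Ideal.span ({z, y, u, t} : Set R) := Ideal.subset_span (by simp)
  have hy : y ∈ Ideal.span ({z, y, u, t} : Set R) := Ideal.subset_span (by simp)
  have hu : u ∈ Ideal.span ({z, y, u, t} : Set R) := Ideal.subset_span (by simp)
  have ht : t ∈ Ideal.span ({z, y, u, t} : Set R) := Ideal.subset_span (by simp)
  have hy2 : y ^ 2 ∈ Ideal.span ({z, y, u, t} : Set R) := by rw [sq]; exact Ideal.mul_mem_left _ _ hy
  have hu2 : u ^ 2 ∈ Ideal.span ({z, y, u, t} : Set R) := by rw [sq]; exact Ideal.mul_mem_left _ _ hu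
  have ht2 : t ^ 2 ∈ Ideal.span ({z, y, u, t} : Set R) := by rw [sq]; exact Ideal.mul_mem_left _ _ ht
  subst hW
  fin_cases i <;> fin_cases j <;> simp only [of_apply, cons_val', cons_val_zero, cons_val_one, cons_val, empty_val',
    cons_val_fin_one, Fin.isValue, Fin.mk_one, Fin.zero_eta, Fin.reduceFinMk] <;>
    first | exact Submodule.zero_mem _ | assumption

/-- Hence **every `k × k` minor of `W′` lies in `𝔫ᵏ`** (any row/column selection `r c : Fin k → Fin 8`). [folklore] -/
theorem det_submatrix_mem_pow (y u t z : R) (W : Matrix (Fin 8) (Fin 8) R)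
    (hW : W = !![z, y, u, t, 0, 0, 0, 0;
      y ^ 2, z, 0, 0, u, t, 0, 0;
      u ^ 2, 0, z, 0, y, 0, t, 0;
      t ^ 2, 0, 0, z, 0, y, u, 0;
      0, u ^ 2, y ^ 2, 0, z, 0, 0, t;
      0, t ^ 2, 0, y ^ 2, 0, z, 0, u;
      0, 0, t ^ 2, u ^ 2, 0, 0, z, y;
      0, 0, 0, 0, t ^ 2, u ^ 2, y ^ 2, z]) {k : ℕ} (r c : Fin k → Fin 8) :
    (W.submatrix r c).det ∈ Ideal.span ({z, y, u, t} : Set R) ^ k := by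
  have h := det_mem_pow_of_forall_mem (Ideal.span ({z, y, u, t} : Set R)) (W.submatrix r c)
    fun i j => entry_mem_span y u t z W hW (r i) (c j)
  rwa [Fintype.card_fin] at h

/-! ## §4 `𝔫² ⊆ I₂(W′)` by ten explicit minors -/

/-- **`𝔫² ≤ I₂(W′)`**: the ideal generated by the `2 × 2` minors of `W′` contains `(z, y, u, t)²`. The minors used: `y², u², t², yu, yt, ut, zy, zu, zt` occur
on the nose, and `z² = (z·z − y·y²) + y·y²`. [by inspection] -/
theorem sq_span_le_span_minors_two (y u t z : R) (W : Matrix (Fin 8) (Fin 8) R)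
    (hW : W = !![z, y, u, t, 0, 0, 0, 0;
      y ^ 2, z, 0, 0, u, t, 0, 0;
      u ^ 2, 0, z, 0, y, 0, t, 0;
      t ^ 2, 0, 0, z, 0, y, u, 0;
      0, u ^ 2, y ^ 2, 0, z, 0, 0, t;
      0, t ^ 2, 0, y ^ 2, 0, z, 0, u;
      0, 0, t ^ 2, u ^ 2, 0, 0, z, y;
      0, 0, 0, 0, t ^ 2, u ^ 2, y ^ 2, z]) :
    Ideal.span ({z, y, u, t} : Set R) ^ 2 ≤
      Ideal.span {d : R | ∃ r c : Fin 2 → Fin 8, Function.Injective r ∧ Function.Injective c ∧ d = (W.submatrix r c).det} := by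
  set I₂ : Ideal R := Ideal.span {d : R | ∃ r c : Fin 2 → Fin 8, Function.Injective r ∧ Function.Injective c ∧ d = (W.submatrix r c).det}
    with hI₂
  -- a minor with prescribed injective row/column selections lies in `I₂`
  have minor_mem : ∀ r c : Fin 2 → Fin 8, Function.Injective r → Function.Injective c → (W.submatrix r c).det ∈ I₂ :=
    fun r c hr hc => Ideal.subset_span ⟨r, c, hr, hc, rfl⟩
  -- the ten evaluations
  have ev : ∀ r c : Fin 2 → Fin 8, (W.submatrix r c).det = W (r 0) (c 0) * W (r 1) (c 1) - W (r 0) (c 1) * W (r 1) (c 0) :=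
    fun r c => by rw [Matrix.det_fin_two]; rfl
  have mk : ∀ (r c : Fin 2 → Fin 8) (e : R), Function.Injective r → Function.Injective c →
      (W.submatrix r c).det = e → e ∈ I₂ := fun r c e hr hc he => he ▸ minor_mem r c hr hc
  have hyy : y * y ∈ I₂ := mk ![0, 2] ![1, 4] _ (by decide) (by decide) (by rw [ev]; subst hW; simp)
  have huu : u * u ∈ I₂ := mk ![0, 1] ![2, 4] _ (by decide) (by decide) (by rw [ev]; subst hW; simp)
  have htt : t * t ∈ I₂ := mk ![0, 1] ![3, 5] _ (by decide) (by decide) (by rw [ev]; subst hW; simp)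
  have hyu : y * u ∈ I₂ := mk ![0, 3] ![1, 6] _ (by decide) (by decide) (by rw [ev]; subst hW; simp)
  have hyt : y * t ∈ I₂ := mk ![0, 2] ![1, 6] _ (by decide) (by decide) (by rw [ev]; subst hW; simp)
  have hut : u * t ∈ I₂ := mk ![0, 1] ![2, 5] _ (by decide) (by decide) (by rw [ev]; subst hW; simp)
  have hzy : z * y ∈ I₂ := mk ![0, 2] ![0, 4] _ (by decide) (by decide) (by rw [ev]; subst hW; simp)
  have hzu : z * u ∈ I₂ := mk ![0, 1] ![0, 4] _ (by decide) (by decide) (by rw [ev]; subst hW; simp)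
  have hzt : z * t ∈ I₂ := mk ![0, 1] ![0, 5] _ (by decide) (by decide) (by rw [ev]; subst hW; simp)
  have hzz : z * z ∈ I₂ := by
    have h' : z * z - y * (y * y) ∈ I₂ :=
      mk ![0, 1] ![0, 1] _ (by decide) (by decide) (by rw [ev]; subst hW; simp; ring)
    have : z * z = (z * z - y * (y * y)) + y * (y * y) := by ring
    rw [this]
    exact I₂.add_mem h' (I₂.mul_mem_left y hyy)
  -- assemble: `(span S)² = span (S * S)` and the sixteen products
  rw [sq, Ideal.span_mul_span']
  refine Ideal.span_le.mpr ?_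
  rintro _ ⟨a, ha, b, hb, rfl⟩
  change a * b ∈ I₂
  simp only [Set.mem_insert_iff, Set.mem_singleton_iff] at ha hb
  rcases ha with rfl | rfl | rfl | rfl <;> rcases hb with rfl | rfl | rfl | rfl <;>
    first | assumption | (rw [mul_comm]; assumption)

end Summit.ResolutionOfSingularities.ResolutionOfSingularities.Theorems.FInjectiveMacaulayfication.NormBlockMatrix
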